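import Literature.NumberTheory.Sieve.PolynomialValuesSieveSequence
import Literature.NumberTheory.Sieve.SieveFramework
import HarnessLib

/-!
# Route `LeeYangFibres`, crux `AbsoluteUpgrade` (stmt-Parity-14116), line `nlc-cells-absolute-clip`:
# helper file 1 for the stub `stub_singlesDecay` — polynomial values over an integer index set as a
# sifted sequence

Pure sieve bookkeeping (no linear forms yet).  For `F ∈ ℤ[X]`, a finite index set `S ⊆ ℤ` and an
expected size `X`, `valSeq F S X` is the sifted sequence ON THE VALUES `v = F(n)`:
`a_v = #{n ∈ S : F(n) = v}`, size `X`, density `g(m) = ω_F(m)/m` (the tree's multiplicative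
`rootDensity`).  This is the tree's `polyAPSeq` (`PolynomialValuesSieveSequence.lean`, index set a
progression of naturals) with an arbitrary finite set of INTEGERS as index set; the dictionary is the
same:

* `valSeq_sifted` — `S(𝒜, P; x) = #{n ∈ S : (F(n), P) = 1}` once `0 < F(n) ≤ x` on `S`;
* `valSeq_congrSum` — `A_m(x) = #{n ∈ S : m ∣ F(n)}`;
* `valSeq_densityProduct` — `V(P(z)) = ∏_{p<z} (1 − ω_F(p)/p)`;
* `card_filter_dvd_eval_eq_sum` — `#{n ∈ S : m ∣ F(n)} = ∑_{s mod m, m ∣ F(s)} #{n ∈ S : n ≡ s (m)}`;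
* `valSeq_remainder_eq`, `abs_valSeq_remainder_le` — the remainder is
  `R_m = ∑_{s mod m, m ∣ F(s)} (#{n ∈ S : n ≡ s (m)} − X/m)`, so
  `|R_m| ≤ ∑_{s} |#{n ∈ S : n ≡ s (m)} − X/m|` (`ω_F(m)` classes).

Consumed by the proof of `SinglesDecay` (sieve the products `∏_k ψ_k(n)` over the sign classes of
`λ(ψ_i(n))`).  References: H. Halberstam, H.-E. Richert, *Sieve Methods* (1974), Ch. 1, Examples 3
and 5 [HalberstamRichert1974].
-/

noncomputable section

open Finset Polynomial

namespace Summit.Parity.GeneralizedHardyLittlewood.Theorems.AbsoluteUpgrade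

open Literature.NumberTheory.Sieve

/-! ### The roots of `F` modulo `m` -/

/-- `rootsMod F m = {0 ≤ s < m : m ∣ F(s)}`, the roots of `F` modulo `m` (as natural numbers).
[folklore] -/
def rootsMod (F : ℤ[X]) (m : ℕ) : Finset ℕ :=
  (range m).filter fun s : ℕ => (m : ℤ) ∣ F.eval (s : ℤ)

/-- `#rootsMod F m = ω_F(m)` (the tree's `polyRootCountMod ![F] m`). [folklore] -/
theorem card_rootsMod (F : ℤ[X]) (m : ℕ) : #(rootsMod F m) = polyRootCountMod ![F] m :=
  card_filter_dvd_eval_eq_polyRootCountMod F m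

/-- Membership in `rootsMod`. [folklore] -/
theorem mem_rootsMod {F : ℤ[X]} {m s : ℕ} :
    s ∈ rootsMod F m ↔ s < m ∧ (m : ℤ) ∣ F.eval (s : ℤ) := by
  rw [rootsMod, mem_filter, mem_range]

/-- `m ∣ F(n) ↔ m ∣ F(n')` when `n ≡ n' (mod m)` (`n − n' ∣ F(n) − F(n')`). [folklore] -/
theorem dvd_eval_iff_of_modEq (F : ℤ[X]) {m : ℕ} {n n' : ℤ} (h : n ≡ n' [ZMOD m]) :
    (m : ℤ) ∣ F.eval n ↔ (m : ℤ) ∣ F.eval n' := by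
  have hsub : (m : ℤ) ∣ F.eval n - F.eval n' :=
    dvd_trans ((Int.modEq_iff_dvd.mp h.symm)) (Polynomial.sub_dvd_eval_sub n n' F)
  constructor
  · intro hn
    have := dvd_sub hn hsub
    rwa [sub_sub_cancel] at this
  · intro hn'
    have := dvd_add hn' hsub
    rwa [add_sub_cancel] at this

/-- Partition by the residue of `n` modulo `m ≥ 1`:
`#{n ∈ S : m ∣ F(n)} = ∑_{0 ≤ s < m, m ∣ F(s)} #{n ∈ S : n ≡ s (mod m)}` for `S ⊆ ℤ`. [folklore] -/
theorem card_filter_dvd_eval_eq_sum (F : ℤ[X]) (S : Finset ℤ) {m : ℕ} (hm : 0 < m) :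
    #(S.filter fun n : ℤ => (m : ℤ) ∣ F.eval n) =
      ∑ s ∈ rootsMod F m, #(S.filter fun n : ℤ => n ≡ (s : ℤ) [ZMOD m]) := by
  have hm0 : (m : ℤ) ≠ 0 := by exact_mod_cast hm.ne'
  -- the residue of `n` as a natural number, and its basic properties
  have hres : ∀ n : ℤ, (((n % m).toNat : ℕ) : ℤ) = n % m := fun n =>
    Int.toNat_of_nonneg (Int.emod_nonneg n hm0)
  have hreslt : ∀ n : ℤ, (n % m).toNat < m := fun n => by
    have h := Int.emod_lt_of_pos n (by exact_mod_cast hm : (0 : ℤ) < m)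
    omega
  have hmodEq : ∀ n : ℤ, n ≡ (((n % m).toNat : ℕ) : ℤ) [ZMOD m] := fun n => by
    rw [hres, Int.ModEq, Int.emod_emod_of_dvd n (dvd_refl (m : ℤ))]
  rw [Finset.card_eq_sum_card_fiberwise (f := fun n : ℤ => (n % m).toNat) (t := rootsMod F m) ?_]
  · refine Finset.sum_congr rfl fun s hs => ?_
    obtain ⟨hsm, hsd⟩ := mem_rootsMod.mp hs
    congr 1
    ext n
    simp only [Finset.mem_filter]
    constructor
    · rintro ⟨⟨hn, -⟩, hmod⟩
      refine ⟨hn, ?_⟩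
      have := hmodEq n
      rwa [hmod] at this
    · rintro ⟨hn, hmod⟩
      have hs' : (n % m).toNat = s := by
        have h2 : (s : ℤ) % (m : ℤ) = s :=
          Int.emod_eq_of_lt (Int.natCast_nonneg s) (by exact_mod_cast hsm)
        have h1 : n % (m : ℤ) = (s : ℤ) % (m : ℤ) := hmod
        rw [h2] at h1
        rw [h1, Int.toNat_natCast]
      exact ⟨⟨hn, (dvd_eval_iff_of_modEq F hmod).mpr hsd⟩, hs'⟩
  · intro n hn
    rw [Finset.mem_coe, Finset.mem_filter] at hn
    rw [Finset.mem_coe, mem_rootsMod]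
    exact ⟨hreslt n, (dvd_eval_iff_of_modEq F (hmodEq n)).mp hn.2⟩

/-! ### The sifted sequence of the values `F(n)`, `n ∈ S` -/

/-- `valSeq F S X`: the values `F(n)`, `n ∈ S ⊆ ℤ`, as a sifted sequence on the values — weights
`a_v = #{n ∈ S : F(n) = v}` (`v ≥ 1`), expected size `X`, density `g(m) = ω_F(m)/m`
(Halberstam–Richert Ch. 1, Examples 3 and 5). [folklore] -/
def valSeq (F : ℤ[X]) (S : Finset ℤ) (X : ℝ) : SieveSequence where
  a v := ((#(S.filter fun n : ℤ => F.eval n = (v : ℤ)) : ℕ) : ℝ)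
  a_nonneg _ := Nat.cast_nonneg _
  size _ := X
  density := rootDensity F
  density_mult := isMultiplicative_rootDensity F

/-- Unfolding lemma for the weights. [folklore] -/
theorem valSeq_a (F : ℤ[X]) (S : Finset ℤ) (X : ℝ) (v : ℕ) :
    (valSeq F S X).a v = #(S.filter fun n : ℤ => F.eval n = (v : ℤ)) := rfl

/-- Unfolding lemma for the size. [folklore] -/
theorem valSeq_size (F : ℤ[X]) (S : Finset ℤ) (X x : ℝ) : (valSeq F S X).size x = X := rfl

/-- Unfolding lemma for the density. [folklore] -/
theorem valSeq_density (F : ℤ[X]) (S : Finset ℤ) (X : ℝ) :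
    (valSeq F S X).density = rootDensity F := rfl

/-- **Counting through the values.** If `0 < F(n) ≤ x` for all `n ∈ S`, then for any property `Q`
of the value, `∑_{1 ≤ v ≤ x, Q(v)} a_v = #{n ∈ S : Q(|F(n)|)}`. [folklore] -/
theorem sum_filter_valSeq_a_eq_card (F : ℤ[X]) (S : Finset ℤ) (X : ℝ) {x : ℝ}
    (hx : ∀ n ∈ S, 0 < F.eval n ∧ ((F.eval n : ℤ) : ℝ) ≤ x) (Q : ℕ → Prop) [DecidablePred Q] :
    ∑ v ∈ (Ioc 0 ⌊x⌋₊).filter Q, (valSeq F S X).a v =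
      #(S.filter fun n : ℤ => Q (F.eval n).natAbs) := by
  -- adapted from `Literature.NumberTheory.Sieve.sum_filter_polyAPSeq_a_eq_card`
  simp only [valSeq_a]
  have hfib : ∀ v : ℕ, (S.filter fun n : ℤ => F.eval n = (v : ℤ)) =
      S.filter fun n : ℤ => (F.eval n).natAbs = v := by
    intro v
    refine Finset.filter_congr fun n hn => ?_
    have h0 := (hx n hn).1
    constructor
    · intro h; rw [h, Int.natAbs_natCast]
    · intro h; rw [← h, Int.natAbs_of_nonneg h0.le]
  simp_rw [hfib]
  rw [← Nat.cast_sum, Finset.sum_card_fiberwise_eq_card_filter]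
  congr 2
  ext n
  simp only [Finset.mem_filter, Finset.mem_Ioc, and_congr_right_iff]
  intro hn
  obtain ⟨h0, hle⟩ := hx n hn
  have hv0 : 0 < (F.eval n).natAbs := Int.natAbs_pos.mpr h0.ne'
  have hvx : (F.eval n).natAbs ≤ ⌊x⌋₊ := by
    refine Nat.le_floor ?_
    have : (((F.eval n).natAbs : ℤ) : ℝ) = ((F.eval n : ℤ) : ℝ) := by
      rw [Int.natAbs_of_nonneg h0.le]
    rw [← Int.cast_natCast, this]
    exact hle
  exact ⟨fun h => h.2, fun h => ⟨⟨hv0, hvx⟩, h⟩⟩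

/-- **The sifting function counts:** `S(𝒜, P; x) = #{n ∈ S : (F(n), P) = 1}` once `0 < F(n) ≤ x`
on `S`. [folklore] -/
theorem valSeq_sifted (F : ℤ[X]) (S : Finset ℤ) (X : ℝ) {x : ℝ}
    (hx : ∀ n ∈ S, 0 < F.eval n ∧ ((F.eval n : ℤ) : ℝ) ≤ x) (P : ℕ) :
    (valSeq F S X).sifted x P = #(S.filter fun n : ℤ => (F.eval n).natAbs.Coprime P) :=
  sum_filter_valSeq_a_eq_card F S X hx _

/-- **The congruence sums count:** `A_m(x) = #{n ∈ S : m ∣ F(n)}` once `0 < F(n) ≤ x` on `S`.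
[folklore] -/
theorem valSeq_congrSum (F : ℤ[X]) (S : Finset ℤ) (X : ℝ) {x : ℝ}
    (hx : ∀ n ∈ S, 0 < F.eval n ∧ ((F.eval n : ℤ) : ℝ) ≤ x) (m : ℕ) :
    (valSeq F S X).congrSum m x = #(S.filter fun n : ℤ => (m : ℤ) ∣ F.eval n) := by
  rw [SieveSequence.congrSum, sum_filter_valSeq_a_eq_card F S X hx]
  congr 2
  refine Finset.filter_congr fun n _ => ?_
  exact Int.natCast_dvd.symm

/-- `V(P(z)) = ∏_{p < z} (1 − ω_F(p)/p)` for the value sequence. [folklore] -/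
theorem valSeq_densityProduct (F : ℤ[X]) (S : Finset ℤ) (X : ℝ) (z : ℝ) :
    (valSeq F S X).densityProduct (primesProdBelow z) =
      ∏ p ∈ Nat.primesBelow ⌈z⌉₊, (1 - (polyRootCountMod ![F] p : ℝ) / p) := by
  rw [SieveSequence.densityProduct, primeFactors_primesProdBelow]
  rfl

/-- **The remainder, class by class:** for `m ≥ 1` and `0 < F(n) ≤ x` on `S`,
`R_m(x) = ∑_{0 ≤ s < m, m ∣ F(s)} (#{n ∈ S : n ≡ s (mod m)} − X/m)` (there are `ω_F(m)` classes, and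
`g(m) X = ω_F(m) · X/m`). [folklore] -/
theorem valSeq_remainder_eq (F : ℤ[X]) (S : Finset ℤ) (X : ℝ) {x : ℝ}
    (hx : ∀ n ∈ S, 0 < F.eval n ∧ ((F.eval n : ℤ) : ℝ) ≤ x) {m : ℕ} (hm : 0 < m) :
    (valSeq F S X).remainder m x =
      ∑ s ∈ rootsMod F m, ((#(S.filter fun n : ℤ => n ≡ (s : ℤ) [ZMOD m]) : ℝ) - X / m) := by
  rw [SieveSequence.remainder, valSeq_congrSum F S X hx, valSeq_density, valSeq_size,
    rootDensity_apply, card_filter_dvd_eval_eq_sum F S hm, Nat.cast_sum, Finset.sum_sub_distrib,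
    Finset.sum_const, card_rootsMod, nsmul_eq_mul]
  ring

/-- **The remainder bound, class by class:** `|R_m(x)| ≤ ∑_{s} |#{n ∈ S : n ≡ s (mod m)} − X/m|`,
the sum over the `ω_F(m)` roots `s` of `F` modulo `m` (registered sub-goal of stmt-Parity-14116 for
the stub `stub_singlesDecay`). [folklore] -/
theorem abs_valSeq_remainder_le : ∀ (F : Polynomial ℤ) (S : Finset ℤ) (X : ℝ) {x : ℝ}, (∀ n ∈ S, 0 < Polynomial.eval n F ∧ ((Polynomial.eval n F : ℤ) : ℝ) ≤ x) → ∀ {m : ℕ}, 0 < m → |(valSeq F S X).remainder m x| ≤ ∑ s ∈ rootsMod F m, |((#(S.filter fun n : ℤ => n ≡ (s : ℤ) [ZMOD m]) : ℝ) - X / m)| := by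
  intro F S X x hx m hm
  rw [valSeq_remainder_eq F S X hx hm]
  exact Finset.abs_sum_le_sum_abs _ _

/-- `0 ≤ V(P) ≤ 1` for the value sequence (each factor `1 − ω_F(p)/p` lies in `[0, 1]`). [folklore] -/
theorem valSeq_densityProduct_mem (F : ℤ[X]) (S : Finset ℤ) (X : ℝ) (P : ℕ) :
    0 ≤ (valSeq F S X).densityProduct P ∧ (valSeq F S X).densityProduct P ≤ 1 := by
  unfold SieveSequence.densityProduct
  rw [valSeq_density]
  have h1 : ∀ p ∈ P.primeFactors, 0 ≤ 1 - rootDensity F p := fun p _ =>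
    sub_nonneg.2 (rootDensity_le_one F p)
  have h2 : ∀ p ∈ P.primeFactors, 1 - rootDensity F p ≤ 1 := fun p _ =>
    sub_le_self _ (rootDensity_nonneg F p)
  exact ⟨Finset.prod_nonneg h1, Finset.prod_le_one h1 h2⟩

end Summit.Parity.GeneralizedHardyLittlewood.Theorems.AbsoluteUpgrade

end
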